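import Summits.AtomisticToContinuum.HydrodynamicLimit.Theorems.BoxDissipativeWeakStrongFluxClosureOfParts
import Summits.AtomisticToContinuum.HydrodynamicLimit.Theorems.BoxDissipativeWeakStrongFluxClosureCollisionalVirialTight
import Summits.AtomisticToContinuum.HydrodynamicLimit.Theorems.BoxDissipativeWeakStrongLocalGibbsFineScaleStaticsMain
import HarnessLib

/-!
# Crux `FluxClosure` (stmt-AtomisticToContinuum-9902, route BoxDissipativeWeakStrong), line `registered`,
# rung-0 programme, piece E3: the three LINEAR terms of the momentum-balance defect in global equilibrium

Support file (`--supports stmt-AtomisticToContinuum-9902`) of the continuation lead's rung-0 (global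
equilibrium) programme. In the crux's vocabulary (cube kernel `K`, box momentum `Mm`), under the local Gibbs law
`P_N` with CONSTANT profiles `(a, u, θ)` and GIVEN a uniform-in-time fine-scale momentum bound
`∫⁻ z ∫⁻ x ‖Mm_N(t, z, x) − c₀ • u‖ dP_N ≤ δ_N → 0` (a hypothesis here; it is supplied by a neighbouring piece),
the three linear terms of the pathwise box momentum-balance defect — the momentum pairings `∫⟪Mm, w⟫` at time
`τ` and at time `0`, and the time-integrated pairing `∫_0^τ∫⟪Mm, ∂ₜw⟫` — converge in `L¹(P_N)` to their values at
the constant momentum field `c₀ • u` (`homogeneous_linearTerms`).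

Proof. Boundary terms: for EVERY configuration, `|∫⟪m̂ − m, φ⟫| ≤ sup‖φ‖ · ∫‖m̂ − m‖`
(`e3_ofReal_abs_pairing_sub_le`: both pairings are bounded measurable, `integral_sub`,
`‖∫·‖ₑ ≤ ∫⁻‖·‖ₑ`), with `sup‖w‖` on `[0,τ] × 𝕋³` from compactness
(`Torus.IsSmoothSpaceTimeOn.exists_norm_le_of_isCompact`); integrate in `z` and use the hypothesis.
Interior term: `∂ₜw` is itself jointly smooth on the slab (`Torus.IsSmoothSpaceTimeOn.timeDerivWithin`), so the
same frozen-time bound applies at each `t ∈ (0, τ]`; on the good set of the flow (which carries `P_N`,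
`EntropyClockDock.ae_mem_good_localGibbsLaw`) both time integrands are integrable on `(0, τ]`
(`e3_integrableOn_pairing`, after `FluxClosureB4.integrableOn_Ioc_integral` / `exists_measurable_fderiv`, speeds
bounded by energy conservation `FluxClosureB4.norm_vel_flow_le`), so `|∫ₜ(g_N − g_∞)| ≤ sup‖∂ₜw‖ ∫ₜ∫⁻ₓ‖m̂ − c₀u‖`;
finally Tonelli in `(z, t)` (`e3_lintegral_lintegral_flow_le`: a measurable modification of the flow off the
good set, `HardSphereFlow.measurable_flow_prod_torus`, `lintegral_lintegral_swap`) gives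
`≤ sup‖∂ₜw‖ · τ · δ_N → 0`. No definitions.
References: H. Spohn, *Large Scale Dynamics of Interacting Particles* (1991), Part I §2.3, §3.2–3.3.
-/

noncomputable section

namespace Summit.AtomisticToContinuum.HydrodynamicLimit.Theorems
namespace FluxClosureEq.E3

open scoped BigOperators Topology Classical MeasureTheory ProbabilityTheory InnerProductSpace ENNReal
open Filter Set Function MeasureTheory
open Literature.MathematicalPhysics.KineticTheory Literature.Analysis.FluidPDE Literature.Analysis.FunctionSpaces
open Summit.AtomisticToContinuum.HydrodynamicLimit.Theses.BoxDissipativeWeakStrong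
open Summit.AtomisticToContinuum.HydrodynamicLimit.Theorems.EntropyClockDock (ae_mem_good_localGibbsLaw)

variable {n : ℕ}

/-! ### Frozen-configuration pairing bound -/

/-- The box momentum field `x ↦ m̂(x)` of a fixed configuration (cube kernel of side `l`) is measurable in the
centre variable (finite sum of measurable kernel translates, `FluxClosureB2.measurable_boxK_left`). [folklore] -/
theorem e3_measurable_boxMomentum (c : Config n (Fin 3) T3) (l : ℝ) :
    Measurable fun x : T3 => empiricalMomentumField c
      (fun y => Set.indicator {y' : T3 | ∀ i, ‖y' i - x i‖ < l / 2} (fun _ => (l ^ 3)⁻¹) y) := by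
  simp_rw [empiricalMomentumField_eq_sum]
  exact (Finset.measurable_sum _ fun a _ =>
    (FluxClosureB2.measurable_boxK_left l (c a).1).smul_const (c a).2).const_smul ((n : ℝ)⁻¹)

/-- Joint measurability in `(t, x)` of the box momentum field along a measurable configuration path `γ`, for a
jointly measurable kernel `k` (finite sum over the particles). [folklore] -/
theorem e3_measurable_boxMomentum_path {γ : ℝ → Config n (Fin 3) T3} (hγ : Measurable γ)
    {k : T3 → T3 → ℝ} (hk : Measurable fun q : T3 × T3 => k q.1 q.2) :
    Measurable fun p : ℝ × T3 => empiricalMomentumField (γ p.1) (k p.2) := by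
  have hq : ∀ a, Measurable fun p : ℝ × T3 => k p.2 ((γ p.1) a).1 := fun a =>
    hk.comp (measurable_snd.prodMk ((measurable_pi_apply a).comp (hγ.comp measurable_fst)).fst)
  have hv : ∀ a, Measurable fun p : ℝ × T3 => ((γ p.1) a).2 := fun a =>
    ((measurable_pi_apply a).comp (hγ.comp measurable_fst)).snd
  simp_rw [empiricalMomentumField_eq_sum]
  exact (Finset.measurable_sum _ fun a _ => (hq a).smul (hv a)).const_smul ((n : ℝ)⁻¹)

/-- Measurability in the configuration of the frozen `L¹(𝕋³)` distance of the box momentum field to a constant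
vector, `c ↦ ∫⁻ ofReal ‖m̂_c(x) − m‖ dx` (Fubini measurability, `FluxClosureB5.measurable_momentum`). [folklore] -/
theorem e3_measurable_lintegral_boxMomentum_sub (l : ℝ) (m : V3) :
    Measurable fun c : Config n (Fin 3) T3 => ∫⁻ x : T3, ENNReal.ofReal ‖empiricalMomentumField c
      (fun y => Set.indicator {y' : T3 | ∀ i, ‖y' i - x i‖ < l / 2} (fun _ => (l ^ 3)⁻¹) y) - m‖ := by
  have h := FluxClosureB5.measurable_momentum (n := n)
    (K := fun x y => Set.indicator {y' : T3 | ∀ i, ‖y' i - x i‖ < l / 2} (fun _ => (l ^ 3)⁻¹) y)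
    (LGFS.measurable_boxK_uncurry l)
  exact ((h.sub_const m).norm.ennreal_ofReal).lintegral_prod_right'

/-- `‖m̂(x)‖ ≤ l⁻³ · n⁻¹ Σ_a ‖v_a‖` for the cube kernel of side `l ≥ 0`. [folklore] -/
theorem e3_norm_boxMomentum_le (c : Config n (Fin 3) T3) {l : ℝ} (hl : 0 ≤ l) (x : T3) :
    ‖empiricalMomentumField c
        (fun y => Set.indicator {y' : T3 | ∀ i, ‖y' i - x i‖ < l / 2} (fun _ => (l ^ 3)⁻¹) y)‖ ≤
      (l ^ 3)⁻¹ * ((n : ℝ)⁻¹ * ∑ a, ‖(c a).2‖) := by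
  have hn0 : 0 ≤ (n : ℝ)⁻¹ := inv_nonneg.2 (Nat.cast_nonneg n)
  refine (FluxClosureVT.norm_momentum_le c (fun y => LGFS.boxK_nonneg hl x y)).trans ?_
  calc (n : ℝ)⁻¹ * ∑ a, Set.indicator {y' : T3 | ∀ i, ‖y' i - x i‖ < l / 2} (fun _ => (l ^ 3)⁻¹) (c a).1 * ‖(c a).2‖
      ≤ (n : ℝ)⁻¹ * ∑ a, (l ^ 3)⁻¹ * ‖(c a).2‖ :=
        mul_le_mul_of_nonneg_left (Finset.sum_le_sum fun a _ =>
          mul_le_mul_of_nonneg_right (LGFS.boxK_le hl x _) (norm_nonneg _)) hn0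
    _ = (l ^ 3)⁻¹ * ((n : ℝ)⁻¹ * ∑ a, ‖(c a).2‖) := by rw [← Finset.mul_sum]; ring

/-- **Frozen-configuration pairing bound.** For a configuration `c`, the cube kernel of side `l ≥ 0`, a
measurable test field `φ` with `‖φ‖ ≤ W` and a constant vector `m`:
`ofReal |∫⟪m̂(x), φ(x)⟫ dx − ∫⟪m, φ(x)⟫ dx| ≤ ofReal W · ∫⁻ ofReal ‖m̂(x) − m‖ dx` (both pairings are bounded and
measurable on the probability space `𝕋³`, `integral_sub`, `‖∫·‖ₑ ≤ ∫⁻ ‖·‖ₑ`, Cauchy–Schwarz). [folklore] -/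
theorem e3_ofReal_abs_pairing_sub_le (c : Config n (Fin 3) T3) {l : ℝ} (hl : 0 ≤ l)
    {φ : T3 → V3} (hφm : Measurable φ) {W : ℝ} (hW : ∀ x, ‖φ x‖ ≤ W) (m : V3) :
    ENNReal.ofReal |(∫ x : T3, inner ℝ (empiricalMomentumField c
        (fun y => Set.indicator {y' : T3 | ∀ i, ‖y' i - x i‖ < l / 2} (fun _ => (l ^ 3)⁻¹) y)) (φ x)) -
        ∫ x : T3, inner ℝ m (φ x)| ≤
      ENNReal.ofReal W * ∫⁻ x : T3, ENNReal.ofReal ‖empiricalMomentumField c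
        (fun y => Set.indicator {y' : T3 | ∀ i, ‖y' i - x i‖ < l / 2} (fun _ => (l ^ 3)⁻¹) y) - m‖ := by
  set M : T3 → V3 := fun x => empiricalMomentumField c
    (fun y => Set.indicator {y' : T3 | ∀ i, ‖y' i - x i‖ < l / 2} (fun _ => (l ^ 3)⁻¹) y)
  have hMm : Measurable M := e3_measurable_boxMomentum c l
  have hW0 : 0 ≤ W := (norm_nonneg _).trans (hW 0)
  have hB0 : 0 ≤ (l ^ 3)⁻¹ * ((n : ℝ)⁻¹ * ∑ a, ‖(c a).2‖) :=
    mul_nonneg (inv_nonneg.2 (pow_nonneg hl 3))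
      (mul_nonneg (inv_nonneg.2 (Nat.cast_nonneg n)) (Finset.sum_nonneg fun a _ => norm_nonneg _))
  -- integrability of the two pairings (bounded and measurable on a probability space)
  have h1 : Integrable (fun x => inner ℝ (M x) (φ x)) := by
    refine (integrable_const ((l ^ 3)⁻¹ * ((n : ℝ)⁻¹ * ∑ a, ‖(c a).2‖) * W)).mono'
      (hMm.inner hφm).aestronglyMeasurable (ae_of_all _ fun x => ?_)
    rw [Real.norm_eq_abs]
    exact (abs_real_inner_le_norm _ _).trans
      (mul_le_mul (e3_norm_boxMomentum_le c hl x) (hW x) (norm_nonneg _) hB0)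
  have h2 : Integrable (fun x => inner ℝ m (φ x)) := by
    refine (integrable_const (‖m‖ * W)).mono' (measurable_const.inner hφm).aestronglyMeasurable
      (ae_of_all _ fun x => ?_)
    rw [Real.norm_eq_abs]
    exact (abs_real_inner_le_norm _ _).trans (mul_le_mul_of_nonneg_left (hW x) (norm_nonneg _))
  rw [← integral_sub h1 h2, ← Real.enorm_eq_ofReal_abs]
  refine (enorm_integral_le_lintegral_enorm _).trans ?_
  rw [← lintegral_const_mul' _ _ ENNReal.ofReal_ne_top]
  refine lintegral_mono fun x => ?_
  rw [← inner_sub_left, Real.enorm_eq_ofReal_abs, ← ENNReal.ofReal_mul hW0]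
  refine ENNReal.ofReal_le_ofReal ?_
  calc |inner ℝ (M x - m) (φ x)| ≤ ‖M x - m‖ * ‖φ x‖ := abs_real_inner_le_norm _ _
    _ ≤ ‖M x - m‖ * W := mul_le_mul_of_nonneg_left (hW x) (norm_nonneg _)
    _ = W * ‖M x - m‖ := mul_comm _ _

/-! ### Integrability in time of pairings with `∂ₜw` -/

/-- For `w` smooth on `[0,T) × 𝕋³`, `τ < T`, and a jointly measurable, bounded field `M` on `ℝ × 𝕋³`, the pairing
`t ↦ ∫⟪M(t, x), ∂ₜw(t, x)⟫ dx` is integrable on `(0, τ]` (`∂ₜw` agrees on the slab with the evaluation of a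
measurable, slab-bounded field of linear maps, `FluxClosureB4.exists_measurable_fderiv`; then
`FluxClosureB4.integrableOn_Ioc_integral`). [folklore] -/
theorem e3_integrableOn_pairing {T τ : ℝ} (hτT : τ < T) {w : ℝ → T3 → V3}
    (hw : Torus.IsSmoothSpaceTimeOn (Ico 0 T) w) {M : ℝ → T3 → V3}
    (hM : Measurable fun p : ℝ × T3 => M p.1 p.2) {B : ℝ} (hB : ∀ t x, ‖M t x‖ ≤ B) :
    IntegrableOn (fun t => ∫ x, inner ℝ (M t x) (Torus.timeDerivWithin (Ico 0 T) w t x)) (Ioc 0 τ) := by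
  obtain ⟨H, C, hHm, hHt, -, hHC⟩ := FluxClosureB4.exists_measurable_fderiv hτT hw
  refine FluxClosureB4.integrableOn_Ioc_integral hτT (G := fun p => inner ℝ (M p.1 p.2) (H p (1, 0)))
    (C := B * C) (hM.inner (hHm.apply_continuousLinearMap _)) (fun t ht x => by rw [hHt t ht x])
    fun p hp => ?_
  have hA : ‖H p (1, 0)‖ ≤ C := by
    have h := (H p).le_of_opNorm_le (hHC p.1 hp p.2) ((1 : ℝ), (0 : EuclideanSpace ℝ (Fin 3)))
    rwa [show ‖((1 : ℝ), (0 : EuclideanSpace ℝ (Fin 3)))‖ = 1 by simp [Prod.norm_def], mul_one] at h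
  exact (abs_real_inner_le_norm _ _).trans
    (mul_le_mul (hB _ _) hA (norm_nonneg _) ((norm_nonneg _).trans (hB p.1 p.2)))

/-! ### Tonelli along the flow for a law carried by the good set -/

/-- **Tonelli along the hard-sphere flow.** For a law `μ` carried by the good set of a hard-sphere flow `Ψ` on
`𝕋³`, a measurable `h ≥ 0` on phase space and a real `τ`: if `∫⁻ h(Ψ_t z) dμ ≤ b` for every `t`, then
`∫⁻ (∫⁻_{t ∈ (0,τ]} h(Ψ_t z) dt) dμ ≤ b · τ⁺`. The flow is jointly measurable only on `good × ℝ`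
(`HardSphereFlow.measurable_flow_prod_torus`); we swap the integrals for the measurable modification
`(z, t) ↦ 𝟙[z ∈ good] h(Ψ_t z)` (`Measurable.dite`), which agrees with the integrand for `μ`-a.e. `z`. [folklore] -/
theorem e3_lintegral_lintegral_flow_le {ε : ℝ} (Ψ : HardSphereFlow (Torus.geometry (Fin 3)) ε n)
    {μ : Measure (Config n (Fin 3) T3)} [SFinite μ] (hμ : ∀ᵐ z ∂μ, z ∈ Ψ.good)
    {h : Config n (Fin 3) T3 → ℝ≥0∞} (hh : Measurable h) (τ : ℝ) {b : ℝ≥0∞}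
    (hb : ∀ t, ∫⁻ z, h (Ψ.flow t z) ∂μ ≤ b) :
    ∫⁻ z, (∫⁻ t in Ioc 0 τ, h (Ψ.flow t z)) ∂μ ≤ b * ENNReal.ofReal τ := by
  classical
  set S : Set (Config n (Fin 3) T3 × ℝ) := Ψ.good ×ˢ (univ : Set ℝ) with hS
  have hSm : MeasurableSet S := Ψ.measurableSet_good.prod MeasurableSet.univ
  have hflowS : Measurable fun p : S => h (Ψ.flow p.1.2 p.1.1) := by
    have hmk : Measurable fun p : S => ((⟨p.1.1, (mem_prod.1 p.2).1⟩ : Ψ.good), p.1.2) :=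
      ((measurable_fst.comp measurable_subtype_coe).subtype_mk).prodMk
        (measurable_snd.comp measurable_subtype_coe)
    exact hh.comp (Ψ.measurable_flow_prod_torus.comp hmk)
  set G : Config n (Fin 3) T3 × ℝ → ℝ≥0∞ := fun p =>
    if hp : p ∈ S then h (Ψ.flow p.2 p.1) else 0 with hG
  have hGm : Measurable G := by
    have := Measurable.dite (s := S) (f := fun p : S => h (Ψ.flow p.1.2 p.1.1))
      (g := fun _ => (0 : ℝ≥0∞)) hflowS measurable_const hSm
    convert this using 1
  have hGeq : ∀ z ∈ Ψ.good, ∀ t, G (z, t) = h (Ψ.flow t z) := fun z hz t => by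
    have hp : (z, t) ∈ S := mk_mem_prod hz (mem_univ _)
    simp only [hG, hp, dite_true]
  calc ∫⁻ z, (∫⁻ t in Ioc 0 τ, h (Ψ.flow t z)) ∂μ = ∫⁻ z, (∫⁻ t in Ioc 0 τ, G (z, t)) ∂μ :=
        lintegral_congr_ae (hμ.mono fun z hz => by simp only [hGeq z hz])
    _ = ∫⁻ t in Ioc 0 τ, (∫⁻ z, G (z, t) ∂μ) := lintegral_lintegral_swap hGm.aemeasurable
    _ = ∫⁻ t in Ioc 0 τ, (∫⁻ z, h (Ψ.flow t z) ∂μ) :=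
        lintegral_congr fun t => lintegral_congr_ae (hμ.mono fun z hz => hGeq z hz t)
    _ ≤ ∫⁻ _ in Ioc 0 τ, b := lintegral_mono fun t => hb t
    _ = b * ENNReal.ofReal τ := by rw [setLIntegral_const, Real.volume_Ioc, sub_zero]

/-! ### The registered sub-goal -/

/-- **Rung-0 piece E3 of crux `FluxClosure`: the three linear terms of the defect in global equilibrium.**
In the crux's vocabulary (cube kernel `K`, box momentum `Mm` of the flow `Φ N` at window `0 < ℓ_N ≤ 1`), under
the local Gibbs law `P_N` with constant profiles `(a, u, θ)` and GIVEN `δ_N → 0` with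
`∫⁻ z ∫⁻ x ‖Mm_N(t,z,x) − c₀•u‖ dP_N ≤ δ_N` for all `N, t`: for every `τ ∈ [0,T)` and every `w` smooth on
`[0,T) × 𝕋³`, (i) `∫⁻ |∫⟪Mm_N(τ), w(τ)⟫ − ∫⟪c₀•u, w(τ)⟫| dP_N → 0`, (ii) the same at time `0`, and
(iii) `∫⁻ |∫_{(0,τ]}∫⟪Mm_N, ∂ₜw⟫ − ∫_{(0,τ]}∫⟪c₀•u, ∂ₜw⟫| dP_N → 0`.
Proof: (i),(ii) `e3_ofReal_abs_pairing_sub_le` at the frozen configuration `Φ_s z` with `sup‖w‖` on `[0,τ]×𝕋³`,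
then the hypothesis: `≤ W₀ δ_N`. (iii) on the good set (conull for `P_N`) both time integrands are integrable
(`e3_integrableOn_pairing`; speeds bounded by energy conservation), so the frozen-time bound integrates to
`≤ W₁ ∫⁻_{(0,τ]}∫⁻ₓ‖Mm_N − c₀•u‖`; Tonelli along the flow (`e3_lintegral_lintegral_flow_le`) and the hypothesis
give `≤ W₁ τ δ_N`. Squeeze. -/
theorem homogeneous_linearTerms : ∀ (σ a θ c₀ T : ℝ) (u : V3) (Φ : (N : ℕ) → HardSphereFlow (Torus.geometry (Fin 3)) (hsDiameter σ N) (N + 1)) (ℓ : ℕ → ℝ), (∀ N, 0 < ℓ N ∧ ℓ N ≤ 1) → let K := fun (l : ℝ) (x y : T3) => indicator {y' : T3 | ∀ i, ‖y' i - x i‖ < l / 2} (fun _ => (l ^ 3)⁻¹) y; let Mm := fun N t z x => empiricalMomentumField ((Φ N).flow t z) (K (ℓ N) x); ∀ δ : ℕ → ℝ≥0∞, Tendsto δ atTop (𝓝 0) → (∀ (N : ℕ) (t : ℝ), (∫⁻ z, (∫⁻ x, ENNReal.ofReal ‖Mm N t z x - c₀ • u‖) ∂(localGibbsLaw σ (fun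 _ => a) (fun _ => u) (fun _ => θ) N (Φ N))) ≤ δ N) → ∀ τ ∈ Ico 0 T, ∀ w : ℝ → T3 → V3, Torus.IsSmoothSpaceTimeOn (Ico 0 T) w → Tendsto (fun N : ℕ => ∫⁻ z, ENNReal.ofReal (|(∫ x, inner ℝ (Mm N τ z x) (w τ x)) - ∫ x, inner ℝ (c₀ • u) (w τ x)|) ∂(localGibbsLaw σ (fun _ => a) (fun _ => u) (fun _ => θ) N (Φ N))) atTop (𝓝 0) ∧ Tendsto (fun N : ℕ => ∫⁻ z, ENNReal.ofReal (|(∫ x, inner ℝ (Mm N 0 z x) (w 0 x)) - ∫ x, inner ℝ (c₀ • u) (w 0 x)|) ∂(localGibbsLaw σ (fun _ => a) (fun _ => u) (fun _ => θ) N (Φ N))) atTop (𝓝 0) ∧ Tendsto (fun N : ℕ => ∫⁻ z, ENNReal.ofReal (|(∫ t in Ioc 0 τ, ∫ x, inner ℝ (Mm N t z x) (Torus.timeDerivWithin (Ico 0 T) w t x)) - ∫ t in Ioc 0 τ, ∫ x, inner ℝ (c₀ • u) (Torus.timeDerivWithin (Ico 0 T) w t x)|) ∂(localGibbsLaw σ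 (fun _ => a) (fun _ => u) (fun _ => θ) N (Φ N))) atTop (𝓝 0) := by
  intro σ a θ c₀ T u Φ ℓ hℓ
  dsimp only
  intro δ hδ hMb τ hτ w hw
  have hτ0 : (0 : ℝ) ≤ τ := hτ.1
  have hτT : τ < T := hτ.2
  -- uniform bounds for `w` and `∂ₜw` on `[0, τ] × 𝕋³`
  obtain ⟨W₀, hW₀⟩ := hw.exists_norm_le_of_isCompact isCompact_Icc (Icc_subset_Ico_right hτT)
  have hw' : Torus.IsSmoothSpaceTimeOn (Ico 0 T) (Torus.timeDerivWithin (Ico 0 T) w) :=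
    hw.timeDerivWithin (uniqueDiffOn_Ico 0 T)
  obtain ⟨W₁, hW₁⟩ := hw'.exists_norm_le_of_isCompact isCompact_Icc (Icc_subset_Ico_right hτT)
  -- (i), (ii): boundary terms at any time `s ∈ [0, τ]`
  have hbd : ∀ s ∈ Icc (0 : ℝ) τ, Tendsto (fun N : ℕ => ∫⁻ z, ENNReal.ofReal (|(∫ x : T3, inner ℝ (empiricalMomentumField ((Φ N).flow s z) (fun y => Set.indicator {y' : T3 | ∀ i, ‖y' i - x i‖ < ℓ N / 2} (fun _ => (ℓ N ^ 3)⁻¹) y)) (w s x)) - ∫ x : T3, inner ℝ (c₀ • u) (w s x)|) ∂(localGibbsLaw σ (fun _ => a) (fun _ => u) (fun _ => θ) N (Φ N))) atTop (𝓝 0) := by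
    intro s hs
    have hsT : s ∈ Ico 0 T := ⟨hs.1, lt_of_le_of_lt hs.2 hτT⟩
    have hφm : Measurable (w s) := (hw.isSmooth_slice hsT).continuous.measurable
    have hlim : Tendsto (fun N => ENNReal.ofReal W₀ * δ N) atTop (𝓝 0) := by
      have h := ENNReal.Tendsto.const_mul (a := ENNReal.ofReal W₀) hδ (Or.inr ENNReal.ofReal_ne_top)
      rwa [mul_zero] at h
    refine tendsto_of_tendsto_of_tendsto_of_le_of_le tendsto_const_nhds hlim (fun N => zero_le) fun N => ?_
    calc _ ≤ ∫⁻ z, ENNReal.ofReal W₀ * (∫⁻ x : T3, ENNReal.ofReal ‖empiricalMomentumField ((Φ N).flow s z) (fun y => Set.indicator {y' : T3 | ∀ i, ‖y' i - x i‖ < ℓ N / 2} (fun _ => (ℓ N ^ 3)⁻¹) y) - c₀ • u‖) ∂(localGibbsLaw σ (fun _ => a) (fun _ => u) (fun _ => θ) N (Φ N)) :=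
          lintegral_mono fun z => e3_ofReal_abs_pairing_sub_le ((Φ N).flow s z) (hℓ N).1.le hφm (hW₀ s hs) (c₀ • u)
      _ = ENNReal.ofReal W₀ * ∫⁻ z, (∫⁻ x : T3, ENNReal.ofReal ‖empiricalMomentumField ((Φ N).flow s z) (fun y => Set.indicator {y' : T3 | ∀ i, ‖y' i - x i‖ < ℓ N / 2} (fun _ => (ℓ N ^ 3)⁻¹) y) - c₀ • u‖) ∂(localGibbsLaw σ (fun _ => a) (fun _ => u) (fun _ => θ) N (Φ N)) :=
          lintegral_const_mul' _ _ ENNReal.ofReal_ne_top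
      _ ≤ ENNReal.ofReal W₀ * δ N := mul_le_mul' le_rfl (hMb N s)
  refine ⟨hbd τ ⟨hτ0, le_rfl⟩, hbd 0 ⟨le_rfl, hτ0⟩, ?_⟩
  -- (iii): the time-integrated pairing with `∂ₜw`
  have hlim : Tendsto (fun N => ENNReal.ofReal W₁ * (δ N * ENNReal.ofReal τ)) atTop (𝓝 0) := by
    have h1 := ENNReal.Tendsto.mul_const (b := ENNReal.ofReal τ) hδ (Or.inr ENNReal.ofReal_ne_top)
    rw [zero_mul] at h1
    have h := ENNReal.Tendsto.const_mul (a := ENNReal.ofReal W₁) h1 (Or.inr ENNReal.ofReal_ne_top)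
    rwa [mul_zero] at h
  refine tendsto_of_tendsto_of_tendsto_of_le_of_le tendsto_const_nhds hlim (fun N => zero_le) fun N => ?_
  have hgood : ∀ᵐ z ∂(localGibbsLaw σ (fun _ => a) (fun _ => u) (fun _ => θ) N (Φ N)), z ∈ (Φ N).good :=
    ae_mem_good_localGibbsLaw σ (fun _ => a) (fun _ => θ) (fun _ => u) N (Φ N)
  -- pathwise bound on the good set
  have hpath : ∀ z ∈ (Φ N).good,
      ENNReal.ofReal (|(∫ t in Ioc 0 τ, ∫ x : T3, inner ℝ (empiricalMomentumField ((Φ N).flow t z) (fun y => Set.indicator {y' : T3 | ∀ i, ‖y' i - x i‖ < ℓ N / 2} (fun _ => (ℓ N ^ 3)⁻¹) y)) (Torus.timeDerivWithin (Ico 0 T) w t x)) - ∫ t in Ioc 0 τ, ∫ x : T3, inner ℝ (c₀ • u) (Torus.timeDerivWithin (Ico 0 T) w t x)|) ≤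
        ENNReal.ofReal W₁ * ∫⁻ t in Ioc 0 τ, ∫⁻ x : T3, ENNReal.ofReal ‖empiricalMomentumField ((Φ N).flow t z) (fun y => Set.indicator {y' : T3 | ∀ i, ‖y' i - x i‖ < ℓ N / 2} (fun _ => (ℓ N ^ 3)⁻¹) y) - c₀ • u‖ := by
    intro z hz
    have hγ : Measurable fun t : ℝ => (Φ N).flow t z :=
      (Φ N).measurable_flow_prod_torus.comp
        ((measurable_const (a := (⟨z, hz⟩ : (Φ N).good))).prodMk measurable_id)
    have hMm := e3_measurable_boxMomentum_path hγ
      (k := fun x y => Set.indicator {y' : T3 | ∀ i, ‖y' i - x i‖ < ℓ N / 2} (fun _ => (ℓ N ^ 3)⁻¹) y)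
      (LGFS.measurable_boxK_uncurry (ℓ N))
    have hMb' : ∀ (t : ℝ) (x : T3), ‖empiricalMomentumField ((Φ N).flow t z)
        (fun y => Set.indicator {y' : T3 | ∀ i, ‖y' i - x i‖ < ℓ N / 2} (fun _ => (ℓ N ^ 3)⁻¹) y)‖ ≤
        Real.sqrt (∑ j, ‖(z j).2‖ ^ 2) * (ℓ N ^ 3)⁻¹ := fun t x => by
      obtain ⟨⟨-, hDk⟩, hM, -⟩ := FluxClosureB4.boxAtoms_bounds ((Φ N).flow t z)
        (fun y => LGFS.boxK_nonneg (hℓ N).1.le x y) (fun y => LGFS.boxK_le (hℓ N).1.le x y)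
        (fun i => FluxClosureB4.norm_vel_flow_le (Φ N) hz t i)
      exact hM.trans (mul_le_mul_of_nonneg_left hDk (Real.sqrt_nonneg _))
    have hIa : IntegrableOn (fun t => ∫ x : T3, inner ℝ (empiricalMomentumField ((Φ N).flow t z) (fun y => Set.indicator {y' : T3 | ∀ i, ‖y' i - x i‖ < ℓ N / 2} (fun _ => (ℓ N ^ 3)⁻¹) y)) (Torus.timeDerivWithin (Ico 0 T) w t x)) (Ioc 0 τ) :=
      e3_integrableOn_pairing hτT hw
        (M := fun t x => empiricalMomentumField ((Φ N).flow t z)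
          (fun y => Set.indicator {y' : T3 | ∀ i, ‖y' i - x i‖ < ℓ N / 2} (fun _ => (ℓ N ^ 3)⁻¹) y)) hMm hMb'
    have hIb : IntegrableOn (fun t => ∫ x : T3, inner ℝ (c₀ • u) (Torus.timeDerivWithin (Ico 0 T) w t x)) (Ioc 0 τ) :=
      e3_integrableOn_pairing hτT hw (M := fun _ _ => c₀ • u) measurable_const (fun _ _ => le_rfl)
    rw [← integral_sub hIa hIb, ← Real.enorm_eq_ofReal_abs]
    refine (enorm_integral_le_lintegral_enorm _).trans ?_
    rw [← lintegral_const_mul' _ _ ENNReal.ofReal_ne_top]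
    refine setLIntegral_mono' measurableSet_Ioc fun t ht => ?_
    have htT : t ∈ Ico 0 T := ⟨ht.1.le, lt_of_le_of_lt ht.2 hτT⟩
    rw [Real.enorm_eq_ofReal_abs]
    exact e3_ofReal_abs_pairing_sub_le ((Φ N).flow t z) (hℓ N).1.le
      (hw'.isSmooth_slice htT).continuous.measurable (hW₁ t ⟨ht.1.le, ht.2⟩) (c₀ • u)
  -- Tonelli along the flow and the hypothesis
  have hh := e3_measurable_lintegral_boxMomentum_sub (n := N + 1) (ℓ N) (c₀ • u)
  haveI : SFinite (localGibbsLaw σ (fun _ => a) (fun _ => u) (fun _ => θ) N (Φ N)) := by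
    haveI : SigmaFinite (volume : Measure (T3 × V3)) := inferInstance
    haveI : SigmaFinite (volume : Measure (Config (N + 1) (Fin 3) T3)) := inferInstance
    rw [localGibbsLaw_eq]; unfold localGibbsMeasure; infer_instance
  have hT := e3_lintegral_lintegral_flow_le (Φ N) hgood hh τ (b := δ N) fun t => hMb N t
  calc _ ≤ ∫⁻ z, ENNReal.ofReal W₁ * (∫⁻ t in Ioc 0 τ, ∫⁻ x : T3, ENNReal.ofReal ‖empiricalMomentumField ((Φ N).flow t z) (fun y => Set.indicator {y' : T3 | ∀ i, ‖y' i - x i‖ < ℓ N / 2} (fun _ => (ℓ N ^ 3)⁻¹) y) - c₀ • u‖) ∂(localGibbsLaw σ (fun _ => a) (fun _ => u) (fun _ => θ) N (Φ N)) :=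
        lintegral_mono_ae (hgood.mono fun z hz => hpath z hz)
    _ = ENNReal.ofReal W₁ * ∫⁻ z, (∫⁻ t in Ioc 0 τ, ∫⁻ x : T3, ENNReal.ofReal ‖empiricalMomentumField ((Φ N).flow t z) (fun y => Set.indicator {y' : T3 | ∀ i, ‖y' i - x i‖ < ℓ N / 2} (fun _ => (ℓ N ^ 3)⁻¹) y) - c₀ • u‖) ∂(localGibbsLaw σ (fun _ => a) (fun _ => u) (fun _ => θ) N (Φ N)) :=
        lintegral_const_mul' _ _ ENNReal.ofReal_ne_top
    _ ≤ ENNReal.ofReal W₁ * (δ N * ENNReal.ofReal τ) := mul_le_mul' le_rfl hT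

end FluxClosureEq.E3
end Summit.AtomisticToContinuum.HydrodynamicLimit.Theorems

end
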